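import Summits.CriticalPhenomena.PercolationContinuityZ3.Theorems.Transplant.FKConnectivityAllQWheelNegCorr
import HarnessLib

/-!
# Connectivity correlation inequalities for `φ_{w,q}`, every `q > 0` — THEOREM W′: any two RIM PAIRS of an apex-over-cycle weighted graph (every wheel
# `W_n`, any spoke subset, any weights; adjacent or NON-adjacent rim pairs) are negatively correlated under `φ_{w,q}` for every `0 < q ≤ 1`

Support file (`--supports stmt-CriticalPhenomena-4575`), FK sub-lane `prim-bschramm-fk-3` (gen 8) of the post-continuity programme; builds on
p205010 (kernel theorem, internal audit signed; external expert review pending).  No definitions, no named facts, no sorries; standard axioms.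
Paper proof and blueprint: bschramm/prim-bschramm-fk-3/WHEELS-HUB-NC.md §7.  Companion of `…AllQWheelNegCorr.lean` (THEOREM W, spokes).

**`FK.Wheel.wheel_negCorr_rims`** — same setting as THEOREM W; for the rim pairs `e = s(v y, v (y+1))`, `f = s(v (y+d), v (y+d+1))` (indices mod `n`,
`1 ≤ d ≤ n−1`): `φ_{w,q}(J_e ∩ J_f) ≤ φ_{w,q}(J_e)·φ_{w,q}(J_f)` for every `0 < q ≤ 1`.  Non-adjacent rim pairs of a wheel are DISJOINT pairs (not
covered by negative association at a rim vertex); as far as searched not in print for `q < 1`.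
PROOF: as for THEOREM W with the rim-edge slots: `E(c) = c·1 + (1−c)·K`, `K = [[0,0],[1,q]]` rank one, the two stretches now START with a spoke matrix
(`A = S(p_{y+d})·seg (y+1) (d−1)`, `B = S(p_y)·seg (y+d+1) (n−d−1)`, invariants by `RimInv.spoke_mul`), the word is closed up by `Matrix.trace_mul_comm`, and
the final inequality is `wheelRim_trace_form` (`dEE_nonneg`, `…AllQWheelTransfer.lean`).
[cite: Grimmett2006, §1.4 eq. (1.20) (p. 15); §3.9 eq. (3.94), Conj. (3.96) (pp. 63–66)] [cite: Wagner2006, Thm. 5.8, §5.3 (pp. 14–15)]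
-/

noncomputable section

namespace Summit.CriticalPhenomena.PercolationContinuityZ3.Theorems

namespace FK

namespace Wheel

open Matrix WheelTM Literature.Probability.LatticeModels Literature.Probability.Percolation
open Literature.Probability.Percolation.DecisionTree (ind ind_of_mem ind_of_not_mem ind_nonneg)
open scoped Classical

variable {V : Type*} [Fintype V]

section Main

variable {x : V} {v : ℕ → V} {n : ℕ}
variable (hn : 3 ≤ n) (hinj : ∀ j k, j < n → k < n → v j = v k → j = k) (hx : ∀ j, j < n → v j ≠ x) (hcard : Fintype.card V = n + 1)
include hn hinj hx hcard

omit [Fintype V] hn hinj hx hcard in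
/-- Updating a rim pair keeps the support inside the wheel pairs. [folklore] -/
theorem supp_update_rim (w : Sym2 V → unitInterval) (hsupp : ∀ e, e ∉ wheelPairs x v n → w e = 0) {j : ℕ} (hj : j < n)
    (c : unitInterval) : ∀ e, e ∉ wheelPairs x v n → Function.update w (rimPair v n j) c e = 0 := by
  intro e he
  have hne : e ≠ rimPair v n j := fun h => he (h ▸ (mem_wheelPairs_iff _).2 (Or.inr ⟨j, hj, rfl⟩))
  rw [Function.update_of_ne hne]
  exact hsupp e he

omit [Fintype V] hcard in
/-- **The partition function through the two-slot functional, rim version**: for `w` with the rim pairs of `v y` and `v (y+d)` re-pinned to `a', b'`,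
`Z = q·(Tr(B·E(b')·A·E(a')) − (2−q)·(ρ_Aρ_B)·(a'b'))` with `A = S(p_{y+d})·seg (y+1) (d−1)`, `B = S(p_y)·seg (y+d+1) (n−d−1)`. [folklore] -/
theorem transferT_two_slot_rim (q : ℝ) (w : Sym2 V → unitInterval) {y d : ℕ} (hy : y < n) (hd1 : 1 ≤ d) (hdn : d + 1 ≤ n)
    (a' b' : unitInterval) :
    transferT q (Function.update (Function.update w (rimPair v n y) a') (rimPair v n (y + d)) b') x v n =
      q * (((spokeM (pOf w x v n y) * seg q (pOf w x v n) (rOf w v n) n (y + d + 1) (n - d - 1)) * edgeM q (b' : ℝ) *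
              (spokeM (pOf w x v n ((y + d) % n)) * seg q (pOf w x v n) (rOf w v n) n (y + 1) (d - 1)) * edgeM q (a' : ℝ)).trace -
        (2 - q) * (((∏ i ∈ Finset.range (d - 1), (rOf w v n ((y + 1 + i) % n) * (1 - pOf w x v n ((y + 1 + i) % n)))) *
              (1 - pOf w x v n ((y + d) % n))) *
            ((∏ i ∈ Finset.range (n - d - 1), (rOf w v n ((y + d + 1 + i) % n) * (1 - pOf w x v n ((y + d + 1 + i) % n)))) *
              (1 - pOf w x v n y))) *
          ((a' : ℝ) * (b' : ℝ))) := by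
  have hn1 : 1 ≤ n := by omega
  have hzlt : (y + d) % n < n := Nat.mod_lt _ (by omega)
  have hymod : y % n = y := Nat.mod_eq_of_lt hy
  have hyz : (y + d) % n ≠ y := fun h => mod_add_ne_mod (i := y) (t := d) (n := n) (by omega) (by omega) (h.trans hymod.symm)
  have hrpz : rimPair v n (y + d) = rimPair v n ((y + d) % n) := (rimPair_mod v n (y + d)).symm
  have hL₁ := letter_update_rim hn hinj hx q w hy a'
  have hL : ∀ j, letter q (pOf (Function.update (Function.update w (rimPair v n y) a') (rimPair v n (y + d)) b') x v n)
      (rOf (Function.update (Function.update w (rimPair v n y) a') (rimPair v n (y + d)) b') v n) n j =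
      if j % n = (y + d) % n then edgeM q (b' : ℝ) * spokeM (pOf (Function.update w (rimPair v n y) a') x v n ((y + d) % n))
      else letter q (pOf (Function.update w (rimPair v n y) a') x v n) (rOf (Function.update w (rimPair v n y) a') v n) n j := by
    intro j
    rw [hrpz]
    exact letter_update_rim hn hinj hx q _ hzlt b' j
  have hp₁ : ∀ j, pOf (Function.update w (rimPair v n y) a') x v n j = pOf w x v n j := fun j => pOf_update_rim hn hx w y a' j
  have hLw : ∀ j, j % n ≠ y → j % n ≠ (y + d) % n →
      letter q (pOf (Function.update (Function.update w (rimPair v n y) a') (rimPair v n (y + d)) b') x v n)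
        (rOf (Function.update (Function.update w (rimPair v n y) a') (rimPair v n (y + d)) b') v n) n j =
      letter q (pOf w x v n) (rOf w v n) n j := by
    intro j h1 h2
    rw [hL j, if_neg h2, hL₁ j, if_neg h1]
  have hLy : letter q (pOf (Function.update (Function.update w (rimPair v n y) a') (rimPair v n (y + d)) b') x v n)
      (rOf (Function.update (Function.update w (rimPair v n y) a') (rimPair v n (y + d)) b') v n) n y =
      edgeM q (a' : ℝ) * spokeM (pOf w x v n y) := by
    rw [hL y, if_neg (by rw [hymod]; exact fun h => hyz h.symm), hL₁ y, if_pos hymod]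
  have hLz : letter q (pOf (Function.update (Function.update w (rimPair v n y) a') (rimPair v n (y + d)) b') x v n)
      (rOf (Function.update (Function.update w (rimPair v n y) a') (rimPair v n (y + d)) b') v n) n (y + d) =
      edgeM q (b' : ℝ) * spokeM (pOf w x v n ((y + d) % n)) := by
    rw [hL (y + d), if_pos rfl, hp₁]
  obtain ⟨u, hu⟩ : ∃ u, u = Function.update (Function.update w (rimPair v n y) a') (rimPair v n (y + d)) b' := ⟨_, rfl⟩
  rw [← hu] at hL hLw hLy hLz ⊢
  -- the word read from `y`, closed up by cyclicity of the trace
  have hword : (seg q (pOf u x v n) (rOf u v n) n y n).trace =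
      ((spokeM (pOf w x v n y) * seg q (pOf w x v n) (rOf w v n) n (y + d + 1) (n - d - 1)) * edgeM q (b' : ℝ) *
        (spokeM (pOf w x v n ((y + d) % n)) * seg q (pOf w x v n) (rOf w v n) n (y + 1) (d - 1)) * edgeM q (a' : ℝ)).trace := by
    have e1 : seg q (pOf u x v n) (rOf u v n) n y n = seg q (pOf u x v n) (rOf u v n) n (y + 1) (n - 1) * letter q (pOf u x v n) (rOf u v n) n y := by
      have := seg_add q (pOf u x v n) (rOf u v n) n y 1 (n - 1)
      rw [show 1 + (n - 1) = n by omega] at this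
      rw [this]
      simp only [seg_succ, seg_zero, Matrix.mul_one, Nat.add_zero]
    have e2 : seg q (pOf u x v n) (rOf u v n) n (y + 1) (n - 1) =
        seg q (pOf u x v n) (rOf u v n) n (y + d + 1) (n - d - 1) * letter q (pOf u x v n) (rOf u v n) n (y + d) *
          seg q (pOf u x v n) (rOf u v n) n (y + 1) (d - 1) := by
      have h3 := seg_add q (pOf u x v n) (rOf u v n) n (y + 1) (d - 1) (n - d)
      rw [show d - 1 + (n - d) = n - 1 by omega, show y + 1 + (d - 1) = y + d by omega] at h3
      have h4 := seg_add q (pOf u x v n) (rOf u v n) n (y + d) 1 (n - d - 1)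
      rw [show 1 + (n - d - 1) = n - d by omega] at h4
      rw [h3, h4]
      simp only [seg_succ, seg_zero, Matrix.mul_one, Nat.add_zero]
    have eA : seg q (pOf u x v n) (rOf u v n) n (y + 1) (d - 1) = seg q (pOf w x v n) (rOf w v n) n (y + 1) (d - 1) := by
      refine seg_congr n q _ _ fun j hj hj' => hLw j ?_ ?_
      · obtain ⟨t, rfl⟩ : ∃ t, j = y + t := ⟨j - y, by omega⟩
        exact fun h => mod_add_ne_mod (i := y) (t := t) (n := n) (by omega) (by omega) (h.trans hymod.symm)
      · obtain ⟨t, ht⟩ : ∃ t, y + d = j + t := ⟨y + d - j, by omega⟩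
        rw [ht]; exact fun h => mod_add_ne_mod (i := j) (t := t) (n := n) (by omega) (by omega) h.symm
    have eB : seg q (pOf u x v n) (rOf u v n) n (y + d + 1) (n - d - 1) = seg q (pOf w x v n) (rOf w v n) n (y + d + 1) (n - d - 1) := by
      refine seg_congr n q _ _ fun j hj hj' => hLw j ?_ ?_
      · obtain ⟨t, rfl⟩ : ∃ t, j = y + t := ⟨j - y, by omega⟩
        exact fun h => mod_add_ne_mod (i := y) (t := t) (n := n) (by omega) (by omega) (h.trans hymod.symm)
      · obtain ⟨t, rfl⟩ : ∃ t, j = y + d + t := ⟨j - (y + d), by omega⟩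
        exact mod_add_ne_mod (by omega) (by omega)
    rw [e1, e2, eA, eB, hLy, hLz]
    -- move the last spoke matrix to the front (cyclicity), then regroup
    rw [← Matrix.mul_assoc _ (edgeM q (a' : ℝ)) (spokeM (pOf w x v n y)), Matrix.trace_mul_comm _ (spokeM (pOf w x v n y))]
    simp only [Matrix.mul_assoc]
  -- the correction product
  have hpu : ∀ j, pOf u x v n j = pOf w x v n j := fun j => by rw [hu, pOf_update_rim hn hx _ (y + d) b' j, hp₁]
  have hru : ∀ j, rOf u v n j = if j % n = (y + d) % n then (b' : ℝ) else if j % n = y then (a' : ℝ) else rOf w v n j := by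
    intro j
    rw [hu, hrpz, rOf_update_rim hn hinj _ hzlt b' j]
    by_cases h : j % n = (y + d) % n
    · rw [if_pos h, if_pos h]
    · rw [if_neg h, if_neg h, rOf_update_rim hn hinj w hy a' j]
  have hprod : (∏ j ∈ Finset.range n, rOf u v n j) * ∏ j ∈ Finset.range n, (1 - pOf u x v n j) =
      (((∏ i ∈ Finset.range (d - 1), (rOf w v n ((y + 1 + i) % n) * (1 - pOf w x v n ((y + 1 + i) % n)))) *
          (1 - pOf w x v n ((y + d) % n))) *
        ((∏ i ∈ Finset.range (n - d - 1), (rOf w v n ((y + d + 1 + i) % n) * (1 - pOf w x v n ((y + d + 1 + i) % n)))) *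
          (1 - pOf w x v n y))) * ((a' : ℝ) * (b' : ℝ)) := by
    have hfull : (∏ j ∈ Finset.range n, rOf u v n j) * ∏ j ∈ Finset.range n, (1 - pOf u x v n j) =
        ∏ i ∈ Finset.range n, (fun m => rOf u v n m * (1 - pOf u x v n m)) ((y + i) % n) := by
      rw [← Finset.prod_mul_distrib]
      symm
      refine Finset.prod_nbij (fun i => (y + i) % n) (fun i _ => Finset.mem_range.2 (Nat.mod_lt _ (by omega))) ?_ ?_ (fun i _ => rfl)
      · intro i hi j hj h
        have hi' := Finset.mem_range.1 (Finset.mem_coe.1 hi)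
        have hj' := Finset.mem_range.1 (Finset.mem_coe.1 hj)
        have h2 := Nat.ModEq.add_left_cancel' y (show (y + i) % n = (y + j) % n from h)
        rw [Nat.ModEq, Nat.mod_eq_of_lt hi', Nat.mod_eq_of_lt hj'] at h2
        exact h2
      · intro m hm
        have hm' := Finset.mem_range.1 (Finset.mem_coe.1 hm)
        refine ⟨(m + n - y) % n, Finset.mem_coe.2 (Finset.mem_range.2 (Nat.mod_lt _ (by omega))), ?_⟩
        show (y + (m + n - y) % n) % n = m
        rw [Nat.add_mod, Nat.mod_mod, ← Nat.add_mod, show y + (m + n - y) = m + n by omega, Nat.add_mod_right,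
          Nat.mod_eq_of_lt hm']
    rw [hfull, show Finset.range n = Finset.range (d + 1 + (n - d - 1)) by congr 1; omega,
      prod_range_split (fun i => (fun m => rOf u v n m * (1 - pOf u x v n m)) ((y + i) % n)) (n - d - 1) hd1]
    have fy : rOf u v n ((y + 0) % n) * (1 - pOf u x v n ((y + 0) % n)) = (a' : ℝ) * (1 - pOf w x v n y) := by
      rw [Nat.add_zero, hymod, hru, hpu, hymod, if_neg (fun h => hyz h.symm), if_pos rfl]
    have fz : rOf u v n ((y + d) % n) * (1 - pOf u x v n ((y + d) % n)) = (b' : ℝ) * (1 - pOf w x v n ((y + d) % n)) := by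
      rw [hru, hpu, Nat.mod_mod, if_pos rfl]
    have fA : ∀ i ∈ Finset.range (d - 1), rOf u v n ((y + (1 + i)) % n) * (1 - pOf u x v n ((y + (1 + i)) % n)) =
        rOf w v n ((y + 1 + i) % n) * (1 - pOf w x v n ((y + 1 + i) % n)) := by
      intro i hi
      have hi' := Finset.mem_range.1 hi
      rw [show y + (1 + i) = y + 1 + i by omega, hru, hpu, Nat.mod_mod, if_neg, if_neg]
      · rw [show y + 1 + i = y + (1 + i) by omega]
        exact fun h => mod_add_ne_mod (i := y) (t := 1 + i) (n := n) (by omega) (by omega) (h.trans hymod.symm)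
      · rw [show y + d = (y + 1 + i) + (d - 1 - i) by omega]
        exact fun h => mod_add_ne_mod (i := y + 1 + i) (t := d - 1 - i) (n := n) (by omega) (by omega) h.symm
    have fB : ∀ i ∈ Finset.range (n - d - 1), rOf u v n ((y + (d + 1 + i)) % n) * (1 - pOf u x v n ((y + (d + 1 + i)) % n)) =
        rOf w v n ((y + d + 1 + i) % n) * (1 - pOf w x v n ((y + d + 1 + i) % n)) := by
      intro i hi
      have hi' := Finset.mem_range.1 hi
      rw [show y + (d + 1 + i) = y + d + 1 + i by omega, hru, hpu, Nat.mod_mod, if_neg, if_neg]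
      · rw [show y + d + 1 + i = y + (d + 1 + i) by omega]
        exact fun h => mod_add_ne_mod (i := y) (t := d + 1 + i) (n := n) (by omega) (by omega) (h.trans hymod.symm)
      · rw [show y + d + 1 + i = (y + d) + (1 + i) by omega]; exact mod_add_ne_mod (by omega) (by omega)
    simp only []
    rw [fy, fz, Finset.prod_congr rfl fA, Finset.prod_congr rfl fB]
    ring
  unfold transferT
  rw [← trace_seg_rotate q _ _ n y hy.le, hword, mul_assoc (2 - q) (∏ j ∈ Finset.range n, rOf u v n j), hprod]
  ring

/-- **THEOREM W′ — any two rim pairs of an apex-over-cycle weighted graph are negatively correlated for `0 < q ≤ 1`.**  The pairs are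
`s(v y, v (y+1))` and `s(v (y+d), v (y+d+1))` (indices mod `n`, `1 ≤ d ≤ n−1`). (transcription of bschramm/prim-bschramm-fk-3/WHEELS-HUB-NC.md §7) -/
theorem wheel_negCorr_rims {q : ℝ} (hq0 : 0 < q) (hq1 : q ≤ 1) (w : Sym2 V → unitInterval)
    (hsupp : ∀ e, e ∉ wheelPairs x v n → w e = 0) {y d : ℕ} (hy : y < n) (hd1 : 1 ≤ d) (hdn : d + 1 ≤ n) :
    (rcMeasureW w q ∅).real ({ω : BondConfig V | rimPair v n y ∈ ω} ∩ {ω | rimPair v n (y + d) ∈ ω}) ≤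
      (rcMeasureW w q ∅).real {ω : BondConfig V | rimPair v n y ∈ ω} *
        (rcMeasureW w q ∅).real {ω : BondConfig V | rimPair v n (y + d) ∈ ω} := by
  have hzlt : (y + d) % n < n := Nat.mod_lt _ (by omega)
  have hymod : y % n = y := Nat.mod_eq_of_lt hy
  have hyz : (y + d) % n ≠ y := fun h => mod_add_ne_mod (i := y) (t := d) (n := n) (by omega) (by omega) (h.trans hymod.symm)
  have hrpz : rimPair v n (y + d) = rimPair v n ((y + d) % n) := (rimPair_mod v n (y + d)).symm
  have hfe : rimPair v n (y + d) ≠ rimPair v n y := by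
    rw [hrpz]; exact fun h => hyz ((rimPair_eq_iff hn hinj hzlt hy).1 h)
  have hsupp1 : ∀ (a' b' : unitInterval), ∀ g, g ∉ wheelPairs x v n →
      Function.update (Function.update w (rimPair v n y) a') (rimPair v n (y + d)) b' g = 0 := by
    intro a' b'
    have h1 := supp_update_rim w hsupp hy a'
    rw [hrpz]
    exact supp_update_rim _ h1 hzlt b'
  have hZ : ∀ (a' b' : unitInterval),
      rcPartitionFunctionW (Function.update (Function.update w (rimPair v n y) a') (rimPair v n (y + d)) b') q ∅ =
        transferT q (Function.update (Function.update w (rimPair v n y) a') (rimPair v n (y + d)) b') x v n :=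
    fun a' b' => rcPartitionFunctionW_eq_transferT hn hinj hx hcard q _ (hsupp1 a' b')
  have hT := fun (a' b' : unitInterval) => transferT_two_slot_rim hn hinj hx q w hy hd1 hdn a' b'
  -- the invariants of the stretches
  have hp01 : ∀ j, 0 ≤ pOf w x v n j ∧ pOf w x v n j ≤ 1 := fun j => ⟨(w _).2.1, (w _).2.2⟩
  have hr01 : ∀ j, 0 ≤ rOf w v n j ∧ rOf w v n j ≤ 1 := fun j => ⟨(w _).2.1, (w _).2.2⟩
  have hIA : RimInv q ((∏ i ∈ Finset.range (d - 1), (rOf w v n ((y + 1 + i) % n) * (1 - pOf w x v n ((y + 1 + i) % n)))) *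
        (1 - pOf w x v n ((y + d) % n)))
      (spokeM (pOf w x v n ((y + d) % n)) * seg q (pOf w x v n) (rOf w v n) n (y + 1) (d - 1)) := by
    have h0 := rimInv_seg_mul hq0.le hq1 hp01 hr01 n (y + 1) (RimInv.one q) (d - 1)
    rw [Matrix.mul_one, mul_one] at h0
    have h1 := h0.spoke_mul hq0.le hq1 (hp01 ((y + d) % n)).1 (hp01 ((y + d) % n)).2
    convert h1 using 1
    ring
  have hIB : RimInv q ((∏ i ∈ Finset.range (n - d - 1), (rOf w v n ((y + d + 1 + i) % n) * (1 - pOf w x v n ((y + d + 1 + i) % n)))) *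
        (1 - pOf w x v n y))
      (spokeM (pOf w x v n y) * seg q (pOf w x v n) (rOf w v n) n (y + d + 1) (n - d - 1)) := by
    have h0 := rimInv_seg_mul hq0.le hq1 hp01 hr01 n (y + d + 1) (RimInv.one q) (n - d - 1)
    rw [Matrix.mul_one, mul_one] at h0
    have h1 := h0.spoke_mul hq0.le hq1 (hp01 y).1 (hp01 y).2
    convert h1 using 1
    ring
  have hTF := wheelRim_trace_form hq0.le hq1 hIA hIB
  generalize hA : spokeM (pOf w x v n ((y + d) % n)) * seg q (pOf w x v n) (rOf w v n) n (y + 1) (d - 1) = A at hT hTF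
  generalize hB : spokeM (pOf w x v n y) * seg q (pOf w x v n) (rOf w v n) n (y + d + 1) (n - d - 1) = B at hT hTF
  generalize hρA : (∏ i ∈ Finset.range (d - 1), (rOf w v n ((y + 1 + i) % n) * (1 - pOf w x v n ((y + 1 + i) % n)))) *
      (1 - pOf w x v n ((y + d) % n)) = ρA at hT hTF
  generalize hρB : (∏ i ∈ Finset.range (n - d - 1), (rOf w v n ((y + d + 1 + i) % n) * (1 - pOf w x v n ((y + d + 1 + i) % n)))) *
      (1 - pOf w x v n y) = ρB at hT hTF
  have ha0 : 0 ≤ ((w (rimPair v n y) : unitInterval) : ℝ) := (w _).2.1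
  have ha1 : ((w (rimPair v n y) : unitInterval) : ℝ) ≤ 1 := (w _).2.2
  have hb0 : 0 ≤ ((w (rimPair v n (y + d)) : unitInterval) : ℝ) := (w _).2.1
  have hb1 : ((w (rimPair v n (y + d)) : unitInterval) : ℝ) ≤ 1 := (w _).2.2
  -- masses
  have hZw : rcPartitionFunctionW w q ∅ =
      rcPartitionFunctionW (Function.update (Function.update w (rimPair v n y) (w (rimPair v n y))) (rimPair v n (y + d))
        (w (rimPair v n (y + d)))) q ∅ := by
    rw [Function.update_eq_self, Function.update_eq_self]
  have hSe : ∑ ω : BondConfig V, rcWeightW w q ∅ ω * ind {ω : BondConfig V | rimPair v n y ∈ ω} ω =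
      ((w (rimPair v n y) : unitInterval) : ℝ) *
        rcPartitionFunctionW (Function.update (Function.update w (rimPair v n y) 1) (rimPair v n (y + d)) (w (rimPair v n (y + d)))) q ∅ := by
    rw [sum_openPair_eq_mul_Z w q (rimPair v n y)]
    congr 2
    conv_lhs => rw [← Function.update_eq_self (rimPair v n (y + d)) (Function.update w (rimPair v n y) 1)]
    rw [Function.update_of_ne hfe]
  have hSf : ∑ ω : BondConfig V, rcWeightW w q ∅ ω * ind {ω : BondConfig V | rimPair v n (y + d) ∈ ω} ω =
      ((w (rimPair v n (y + d)) : unitInterval) : ℝ) *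
        rcPartitionFunctionW (Function.update (Function.update w (rimPair v n y) (w (rimPair v n y))) (rimPair v n (y + d)) 1) q ∅ := by
    rw [sum_openPair_eq_mul_Z w q (rimPair v n (y + d)), Function.update_eq_self]
  have hSef : ∑ ω : BondConfig V, rcWeightW w q ∅ ω * ind ({ω : BondConfig V | rimPair v n y ∈ ω} ∩ {ω | rimPair v n (y + d) ∈ ω}) ω =
      ((w (rimPair v n y) : unitInterval) : ℝ) * ((w (rimPair v n (y + d)) : unitInterval) : ℝ) *
        rcPartitionFunctionW (Function.update (Function.update w (rimPair v n y) 1) (rimPair v n (y + d)) 1) q ∅ :=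
    sum_openPair_inter_openPair_eq w q hfe
  -- trace expansion: `E(c) = c·1 + (1−c)·K`
  have tEE : ∀ c c' : ℝ, (B * edgeM q c' * A * edgeM q c).trace =
      c * c' * (A * B).trace + (1 - c) * c' * ((B * A) 0 1 + q * (B * A) 1 1) + c * (1 - c') * ((A * B) 0 1 + q * (A * B) 1 1) +
        (1 - c) * (1 - c') * ((A 0 1 + q * A 1 1) * (B 0 1 + q * B 1 1)) := by
    intro c c'; simp [edgeM, Matrix.trace_fin_two, Matrix.mul_apply, Fin.sum_univ_two]; ring
  have hnn : 0 ≤ q ^ 2 * (((w (rimPair v n y) : unitInterval) : ℝ) * ((w (rimPair v n (y + d)) : unitInterval) : ℝ)) *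
      ((1 - ((w (rimPair v n y) : unitInterval) : ℝ)) * (1 - ((w (rimPair v n (y + d)) : unitInterval) : ℝ))) *
      (((A * B) 0 1 + q * (A * B) 1 1) * ((B * A) 0 1 + q * (B * A) 1 1) -
        ((A * B).trace - (2 - q) * ρA * ρB) * ((A 0 1 + q * A 1 1) * (B 0 1 + q * B 1 1))) := by
    apply mul_nonneg
    · exact mul_nonneg (mul_nonneg (sq_nonneg q) (mul_nonneg ha0 hb0)) (mul_nonneg (sub_nonneg.2 ha1) (sub_nonneg.2 hb1))
    · linarith [hTF]
  have key : ∀ (a b tAB tBAn tABn ll ρ : ℝ),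
      (a * (q * (1 * b * tAB + (1 - 1) * b * tBAn + 1 * (1 - b) * tABn + (1 - 1) * (1 - b) * ll - (2 - q) * ρ * (1 * b)))) *
          (b * (q * (a * 1 * tAB + (1 - a) * 1 * tBAn + a * (1 - 1) * tABn + (1 - a) * (1 - 1) * ll - (2 - q) * ρ * (a * 1)))) -
        (a * b * (q * (1 * 1 * tAB + (1 - 1) * 1 * tBAn + 1 * (1 - 1) * tABn + (1 - 1) * (1 - 1) * ll - (2 - q) * ρ * (1 * 1)))) *
          (q * (a * b * tAB + (1 - a) * b * tBAn + a * (1 - b) * tABn + (1 - a) * (1 - b) * ll - (2 - q) * ρ * (a * b))) =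
      q ^ 2 * (a * b) * ((1 - a) * (1 - b)) * (tABn * tBAn - (tAB - (2 - q) * ρ) * ll) := by
    intro a b tAB tBAn tABn ll ρ; ring
  have main : (∑ ω : BondConfig V, rcWeightW w q ∅ ω * ind ({ω : BondConfig V | rimPair v n y ∈ ω} ∩ {ω | rimPair v n (y + d) ∈ ω}) ω) *
      rcPartitionFunctionW w q ∅ ≤
      (∑ ω : BondConfig V, rcWeightW w q ∅ ω * ind {ω : BondConfig V | rimPair v n y ∈ ω} ω) *
        ∑ ω : BondConfig V, rcWeightW w q ∅ ω * ind {ω : BondConfig V | rimPair v n (y + d) ∈ ω} ω := by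
    rw [hSef, hSe, hSf, hZw, hZ, hZ, hZ, hZ, hT, hT, hT, hT, Set.Icc.coe_one, tEE, tEE, tEE, tEE]
    have k := key ((w (rimPair v n y) : unitInterval) : ℝ) ((w (rimPair v n (y + d)) : unitInterval) : ℝ) (A * B).trace
      ((B * A) 0 1 + q * (B * A) 1 1) ((A * B) 0 1 + q * (A * B) 1 1) ((A 0 1 + q * A 1 1) * (B 0 1 + q * B 1 1)) (ρA * ρB)
    linarith [k, hnn]
  have hZpos := rcPartitionFunctionW_pos w hq0 (∅ : Set V)
  rw [rcMeasureW_real_eq_sum_div w hq0, rcMeasureW_real_eq_sum_div w hq0, rcMeasureW_real_eq_sum_div w hq0, div_mul_div_comm,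
    div_le_div_iff₀ hZpos (mul_pos hZpos hZpos)]
  have h := mul_le_mul_of_nonneg_right main hZpos.le
  linarith [h]

end Main

end Wheel

end FK

end Summit.CriticalPhenomena.PercolationContinuityZ3.Theorems

end
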